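import Summits.Ventures.PercRepro.C041TreeClosure

/-!
# ROW C-041 — THEOREM (trees) on the recursive tree-zone model (mine-3, gen 57; C-041.md §15 (c)–(d), §19)

A rooted marked tree zone is a root with `p` 1-marks, `q` 2-marks and `d` child subtrees (`TZ.node p q d cs`).
The four counts of C-041.md §15 (c) — `g = #{anchor sub-zone all red}`, `t1 = #{type 1}`, `t2 = #{type 2}`,
`k = #{invalid}` — are given by the exact recursion of §15 (c), here taken as the DEFINITION of the four functions
on the recursive model (the dictionary «recursion = counts of the graph zone», §15 (i), is the separate
combinatorial statement). With `a = g + t1`, `b = g + t2` for each child: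
`g = ∏ (a + b)`, `t1 = 2^p ∏ (2a + b − g) − g`, `t2 = 2^q ∏ (a + 2b − g) − g`, and `k` by the four cases of `(p, q)`.

* `TZ` — the trees; `gF`, `t1F`, `t2F`, `kF : TZ → ℝ` — the recursion of §15 (c) (real-valued);
* **`tz_K4`** — THEOREM (trees), C-041.md §15 (d): every tree satisfies the invariant (P), `(g − k)² ≤ t1·t2`
  and `0 ≤ k ≤ g` — one structural induction through `root_K4` (the closure lemma, C041TreeClosure);
* **`tz_cs`** — the one-anchor CONJECTURE (CS) on trees, `(g − k)² ≤ t1·t2`;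
* **`tz_zoneOCube`** — the ZONE O-CUBE on trees, `0 ≤ t1 + t2 + 2k − 2g`, by AM–GM.
-/

namespace PercRepro

namespace TreeClosure

open Finset

/-- A rooted marked tree zone: the root carries `p` 1-marks and `q` 2-marks and has `d` child subtrees. -/
inductive TZ : Type
  | node (p q d : ℕ) (cs : Fin d → TZ) : TZ

/-- The leaf with marks `(p, q)`. -/
def TZ.leaf (p q : ℕ) : TZ := TZ.node p q 0 (fun i => i.elim0)

/-- The four counts of C-041.md §15 (c) as one recursion: `(g, t1, t2, k)` of a root from those of its
children (`a = g + t1`, `b = g + t2`; the four `(p, q)` cases of `k` written as one formula, as in `root_K4`). -/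
noncomputable def TZ.counts : TZ → ℝ × ℝ × ℝ × ℝ
  | .node p q d cs =>
    let g : Fin d → ℝ := fun j => ((cs j).counts).1
    let t1 : Fin d → ℝ := fun j => ((cs j).counts).2.1
    let t2 : Fin d → ℝ := fun j => ((cs j).counts).2.2.1
    let k : Fin d → ℝ := fun j => ((cs j).counts).2.2.2
    (∏ j, (2 * g j + t1 j + t2 j),
      2 ^ p * ∏ j, (2 * g j + 2 * t1 j + t2 j) - ∏ j, (2 * g j + t1 j + t2 j),
      2 ^ q * ∏ j, (2 * g j + t1 j + 2 * t2 j) - ∏ j, (2 * g j + t1 j + t2 j),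
      (if q = 0 then ∏ j, (g j + t1 j + k j) else 0) + (if p = 0 then ∏ j, (g j + t2 j + k j) else 0)
        - (if p = 0 ∧ q = 0 then ∏ j, (g j + k j) else 0))

/-- `g` = the number of states in which the anchor's sub-zone is all red. -/
noncomputable def TZ.gF (t : TZ) : ℝ := t.counts.1
/-- `t1` = the number of admissible states of type 1 at the anchor's sub-zone. -/
noncomputable def TZ.t1F (t : TZ) : ℝ := t.counts.2.1
/-- `t2` = the number of admissible states of type 2 at the anchor's sub-zone. -/
noncomputable def TZ.t2F (t : TZ) : ℝ := t.counts.2.2.1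
/-- `k` = the number of invalid admissible states (no red mark on the red reach of the anchor). -/
noncomputable def TZ.kF (t : TZ) : ℝ := t.counts.2.2.2

/-- The recursion, spelled out on a node. -/
theorem TZ.counts_node (p q d : ℕ) (cs : Fin d → TZ) :
    (TZ.node p q d cs).counts =
      (∏ j, (2 * (cs j).gF + (cs j).t1F + (cs j).t2F),
        2 ^ p * ∏ j, (2 * (cs j).gF + 2 * (cs j).t1F + (cs j).t2F)
          - ∏ j, (2 * (cs j).gF + (cs j).t1F + (cs j).t2F),
        2 ^ q * ∏ j, (2 * (cs j).gF + (cs j).t1F + 2 * (cs j).t2F)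
          - ∏ j, (2 * (cs j).gF + (cs j).t1F + (cs j).t2F),
        (if q = 0 then ∏ j, ((cs j).gF + (cs j).t1F + (cs j).kF) else 0)
          + (if p = 0 then ∏ j, ((cs j).gF + (cs j).t2F + (cs j).kF) else 0)
          - (if p = 0 ∧ q = 0 then ∏ j, ((cs j).gF + (cs j).kF) else 0)) := by
  rfl

/-- The leaf: `(1, 2^p − 1, 2^q − 1, [p = 0 ∨ q = 0])`. -/
theorem TZ.counts_leaf (p q : ℕ) :
    (TZ.leaf p q).counts = (1, 2 ^ p - 1, 2 ^ q - 1, if p = 0 ∨ q = 0 then 1 else 0) := by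
  rw [TZ.leaf, TZ.counts_node]
  simp only [Finset.univ_eq_empty, Finset.prod_empty, mul_one]
  by_cases hp : p = 0 <;> by_cases hq : q = 0 <;> simp [hp, hq]

/-- **THEOREM (trees)** (C-041.md §15 (d), proved in full by §19): every rooted marked tree zone satisfies the
invariant (P) — `(g − k)² ≤ t1·t2` with `0 ≤ k ≤ g` — by structural induction through the closure lemma. -/
theorem tz_K4 : ∀ t : TZ, K4 t.gF t.t1F t.t2F t.kF
  | .node p q d cs => by
    have ih : ∀ j, K4 (cs j).gF (cs j).t1F (cs j).t2F (cs j).kF := fun j => tz_K4 (cs j)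
    have h := root_K4 d (fun j => (cs j).gF) (fun j => (cs j).t1F) (fun j => (cs j).t2F)
      (fun j => (cs j).kF) ih p q
    simpa only [TZ.gF, TZ.t1F, TZ.t2F, TZ.kF, TZ.counts_node] using h

/-- **CONJECTURE (CS) on tree zones with one anchor** (C-041.md §15 (b)): `(F − I)² ≤ T₁·T₂`. -/
theorem tz_cs (t : TZ) : (t.gF - t.kF) ^ 2 ≤ t.t1F * t.t2F := (tz_K4 t).cs

/-- **THE ZONE O-CUBE on tree zones with one anchor** (C-041.md §14 (a), §15 (a)): `T₁ + T₂ + 2I − 2F ≥ 0`. -/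
theorem tz_zoneOCube (t : TZ) : 0 ≤ t.t1F + t.t2F + 2 * t.kF - 2 * t.gF :=
  zoneOCube_nonneg_of_K4 (tz_K4 t)

end TreeClosure

end PercRepro
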